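import Summits.QuantumFields.BalabanUV.T4Continuum.Support.B13StepEndInsOpBalaban
import Summits.QuantumFields.BalabanUV.T4Continuum.Support.SubstrateO1ReadingsShiftRate

/-!
# B13StepEndInsOpSubstrateShiftRate — NE5 ∕ U3: the termwise END face OF RECORD with W4 produced, READ AT BAŁABAN's TIER-B BACKGROUND
# (`B13StepEndInsOpBalaban`, p225077), AT THE SUBSTRATE's COV-SHIFTED O1 INSTANCE `slotsOfRecordShift …` (W-21), ON THE RATE ROAD:
# W1 supplied by substrate-p1's W-21c `SubstrateO1ReadingsShiftRate` BY NAME — the `_rate` twin of this lineage's `B13StepEndInsOpSubstrateShift`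
# (p237176 ∕ p237267) after the row owner's RULING R58 («NO row NE3 input to NE5»): U1b's `NE3Shape (minActReadings …)` binder REPLACED by
# `0 ≤ θ < 1`, row NE2's per-background two-level-consistency binder `hloc` and an abstract potential-readings carrier `Rp` with `LocalRate Rp C θ`

Cell `pub-balaban`, unit `b2b-balaban-t4-ne5-formalise-leaf-10-g14` (NE5 formalisation swarm, LEAF PROVER 10, gen 14; typer `t4/formal/NE5/LEAVES.md` v2.10
CLAIM RULE 1 ∕ 3 ∕ 7 (b)(e): the shift-road re-pointing twins are the AUTHOR lineages' follow-ons; journal INTENT `HOME/CLAIMS.log`, this gen).  WHY THIS FILE: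
the row owner's R58 (l.22206) corrected the W1 dependency of record — the two-level consistency of the coefficient towers read by W1 comes from the
REGULARITY of averaging towers of (α, β)-regular fine fields, i.e. row NE2's own bridge `NE2FromNE3BavgBridge.localRate_regClass_of_bavg_consistent`
(per background `V ∈ dom`: `LocalRate (bgReadings L M (regClass L M (liftR L M (RgV V)))) C θ`), NOT from node NE3's minimal-action readings; the owner's
g38-c `B13ReadingsRecordRate` (p239282) re-packaged the W1 record face accordingly and substrate-p1's W-21c `SubstrateO1ReadingsShiftRate` (p239614) is its
ONE application at `slotsOfRecordShift`.  THIS FILE is p237267 (`B13StepEndInsOpSubstrateShift`) with W1 := W-21c, nothing else: imports this lineage's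
`B13StepEndInsOpBalaban` and substrate-p1's `SubstrateO1ReadingsShiftRate` ONLY; edits nothing (p237267 stays as landed — a true road whose `…_ne3Shape`
W1 packaging is, after R58, a consumed face and not the W1 of record; p226898 stays of record for the unshifted slots' consumers, with its flag); defines NO
species reading (R41) and constructs ∕ discharges NOTHING of the instance (R34) beyond the three by-name readings listed below.
Summits-side new work under the LEAN PLACEMENT RULE (bookkeeping; 0 `def`, 0 cite tags — printed KIND only).
HONEST FRAMING: rung (B)+1 of the FINITE-VOLUME T⁴ continuum programme — NOT infinite volume, NOT a mass gap, NOT the Clay problem, and **NOT A PROOF OF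
NE5** (NOT PRINTED: the series prints ε-UNIFORM bounds, never η-RATES; cell GAPS G-t4-U3-1), NOT a proof of NE2: every theorem is an IMPLICATION whose
wall binders are DISPLAYED HYPOTHESES ABOUT THE SUBSTRATE's LETTERS (`SlotLetters`: factor letters, weights `W`, contour systems `ΓA ∕ ΓB`, kernel ∕
potential tables `dkA … pRB`, insertion letters `ins`, margins `rOp ∕ rHist`), the W1 reading letters (`tow`, `σ`, …), row NE2's per-background `LocalRate`
binder `hloc` and the potential readings' rate `hRp` — asserted nowhere; the substrate's instance is NOT claimed to satisfy any of them; node NE3 does NOT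
occur (R58).  T-S19 ∕ R55 ∕ R56: the reading binders `hcovA ∕ hcovB` are displayed EXACTLY AS W-21c displays them — WINDOWED to `{k : ℕ | k ≤ D.K}` through
the owner's g37-c shapes `ReadsTowerCovAOn ∕ ReadsTowerCovBOn` (`B13ReadingsLevelWindow`); the owner's off-window agreement binder `hoff` is DISCHARGED inside
W-21c from W-21's aligned junk region; this file copies W-21c's binder text and types nothing of the readings itself.  R48 ∕ R49 HONEST LINE:
`slotsOfRecordShift` is the VALUE-TABLE model (poorer than print at MI-R, [Balaban1988RG2Cluster] Lemma 1 (1.33)); Road D `OutputRateFunctionalTables*` is of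
record for MI-R, instance = substrate; VALUE UNCHANGED.  HONEST DEPENDENCY (cell line, verbatim): continuum YM on T⁴ ⇐ BetaPertH ∧ nine spine estimates
(0/9 proved); BetaPertH ⇐ (D1) ∧ (D4) ∧ CAP+tail; G-an2-4 gates asym, D1 and NE2/3/4.

WHAT THIS FILE DOES (compositions BY NAME; no analytic estimate of its own).  At `S₀ := slotsOfRecordShift D ιr cc ag sg Pm 𝒵 domZ Jc Vv mI Lsl` three
binders of this lineage's letters-free END `B13StepEndArithmetic.exists_ne5_of_record_insOp S₀ E₀ cB` are READ BY NAME: (i) W1 `hwer` := substrate-p1's W-21c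
`SubstrateO1ReadingsShiftRate.weightedEntrywiseRate_slotsOfRecordShift_balaban_rate` (the owner's rate-road record face
`B13ReadingsRecordRate.weightedEntrywiseRate_record_balaban_rate_on` AT the shifted instance, slot lines `slotsOfRecordShift_rawA ∕ _rawB` `rfl`, `hoff`
discharged) — so `0 ≤ θ < 1`, row NE2's `hloc` (OPEN row input, displayed), the potential readings' `hRp` (displayed), the (3.35)-class ∕ threshold letters and
the owner's O1 reading ∕ decay ∕ Lipschitz ∕ domination letters AT THE SUBSTRATE's SHIFTED TABLES are displayed, input rate `√(max θ L⁻¹)`; (ii) `hc₁ ∕ hθ0 ∕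
hθ1` of the END := p225077 §1 (`c1_balaban_nonneg`, `sqrt_rate_pos_lt_one … hθ1`); (iii) L01's `hT : TransportReads W` := the FACTORISATION DATUM `(iopAt, hiopA :
Lsl.ins.iopA r U k = iopAt r (transport U) k)` through O1-e's `B13Represents.Assembly.transportReads_of_insOpAt` (W-21 shifts the covariance slot ONLY, so the
insertion-operator slots and the factorisation reading are the unshifted ones, definitionally).  The scalar letters are read off `Lsl` (`rOp`, `rHist`, `ins.ω`);
EVERY OTHER binder of p237267 is displayed VERBATIM.
* §1 `exists_ne5_of_substrateShift_insOp_balaban_rate` — PER TWO-RUN OBJECT `D : DrivenRuns G` and letter package `Lsl`: conclusion LITERALLY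
  `∃ C₅, T4OutputRate.NE5 (B13StepOfRecord.outA (slotsOfRecordShift …) E₀ cB) (B13StepOfRecord.outB (slotsOfRecordShift …) E₀ cB) W κ θ′ C₅` at the PRESCRIBED `θ′`.
* §2 `uniform_ne5_of_substrateShift_insOp_balaban_rate` — ONE `C₅` from the SIZES ONLY (`κ` aside: `G, EA₀, E₀, cA, cB, r₀, Gi, δI, θ′, ω`, W1's constant
  letters `o, d, L, a, α, β, C, a′, B₁, B₂, B₃, Λ₂, …, Λ₅`, `0 ≤ θ < 1`) for EVERY gauge group, driven two-run object, representation, letters, frame, factor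
  index data, EVERY letter package `Lsl` with `Lsl.ins.ω = ω` and factorisation datum, EVERY datum type `BgD` with admissible data `dom ∕ RgV` in the
  (3.35)-class and row NE2's per-background `LocalRate`, EVERY potential-readings carrier `Rp : Readings ιp Xp` with `LocalRate Rp C θ`, towers, O1 letters,
  window, margins, roomy class — built on `B13StepEndArithmetic.uniform_ne5_of_record_insOp` (entry type quantified INSIDE `∃ C₅`): the η-UNIFORMITY is the
  quantifier order `∃ C₅, ∀ D … Lsl … BgD … Rp …`.
CENSUS vs p237267 (binders, by name): MINUS {`𝒞`, `N`, `hNE3`} ∣ PLUS {`hθ0` (§1; in §2 it joins the outer sizes), `hloc`, `Rp`, `hRp`, the free datum sorts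
`BgD ιp Xp`} ∣ CHANGED in type only: `dom : Set BgD`, `RgV : BgD → …`, `hQ ∕ hR` read `Rp` ∣ ORDER otherwise identical ∣ conclusions IDENTICAL (same `θ′`, §2's
`C₅` from the same sizes) — i.e. exactly W-21c's deltas against W-21b.  Headline wording (trigger c5 ∕ referee INFO-38): «END ⇐ instance letters, cov-shifted
slots, rate road», never «leaf instantiated»; 0∕12 leaves on Bałaban's concrete objects; spine 0∕9.  `FlowStep.BetaPertH`, (B), (B^μ) do not occur.  0 sorry;
axioms ⊆ {propext, Classical.choice, Quot.sound}.
-/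

noncomputable section

open scoped BigOperators ComplexConjugate Matrix Matrix.Norms.L2Operator Kronecker
open Metric Set

namespace Summit.QuantumFields.BalabanUV.T4Continuum.B13StepEndInsOpSubstrateShiftRate

open _root_.MeasureTheory
open Literature.MathematicalPhysics.QuantumFieldTheory.Balaban1983to89
open Literature.MathematicalPhysics.QuantumFieldTheory.Balaban1983to89.T4OutputRate (DecayBound NE5)
open Literature.MathematicalPhysics.QuantumFieldTheory.Balaban1983to89.T4InputCauchyRateSpecies (ballClass)
open Literature.MathematicalPhysics.QuantumFieldTheory.Balaban1983to89.T4InputCauchyRateTermwise (TermBound TermBudget TermLineAnalytic)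
open Literature.MathematicalPhysics.QuantumFieldTheory.Balaban1983to89.B5Prop11Plancherel (Cst Cst_nonneg Tor fine)
open Literature.MathematicalPhysics.QuantumFieldTheory.Balaban1983to89.B5G183RateUnitTower (lev lev_neZero)
open Literature.MathematicalPhysics.QuantumFieldTheory.Balaban1983to89.T4EtaRateMin (Readings LocalRate)
open Summit.QuantumFields.BalabanUV.T4Continuum
open Summit.QuantumFields.BalabanUV.T4Continuum.B13Carriers (TwoRuns)
open Summit.QuantumFields.BalabanUV.T4Continuum.B13OpDatum
open Summit.QuantumFields.BalabanUV.T4Continuum.B13OpDatumJunctions (RawBounded WeightedEntrywiseRate)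
open Summit.QuantumFields.BalabanUV.T4Continuum.B13StepTermLabels (TermIdx InnerLabel)
open Summit.QuantumFields.BalabanUV.T4Continuum.B13StepTermFamily (term)
open Summit.QuantumFields.BalabanUV.T4Continuum.B13InnerData (Bnd)
open Summit.QuantumFields.BalabanUV.T4Continuum.B13Base (selfCtr)
open Summit.QuantumFields.BalabanUV.T4Continuum.B13HistMeasurable (MeasPotFrame B13HistM)
open Summit.QuantumFields.BalabanUV.T4Continuum.B13StepOfRecord (Slots assembly step outA outB)
open Summit.QuantumFields.BalabanUV.T4Continuum.B13StepEndArithmetic (exists_ne5_of_record_insOp uniform_ne5_of_record_insOp)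
open Summit.QuantumFields.BalabanUV.T4Continuum.B13StepEndInsOpBalaban (sqrt_rate_pos_lt_one c1_balaban_nonneg)
open Summit.QuantumFields.BalabanUV.T4Continuum.B13ReadingsDecay (ReadsTowerCovA ReadsTowerCovB CovWeightDominatesDist)
open Summit.QuantumFields.BalabanUV.T4Continuum.B13ReadingsImage
open Summit.QuantumFields.BalabanUV.T4Continuum.B13ReadingsLocal (PotQLipschitzReading PotRLipschitzReading)
open Summit.QuantumFields.BalabanUV.T4Continuum.B13ReadingsAssembly (CpertRec)
open Summit.QuantumFields.BalabanUV.T4Continuum.SubstrateO1ReadingsShiftRate (weightedEntrywiseRate_slotsOfRecordShift_balaban_rate)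
open Summit.QuantumFields.BalabanUV.T4Continuum.DecayRateInterpolation (EntryDecay)
open Summit.QuantumFields.BalabanUV.T4Continuum.CovariantBlockAveraging (ContourSystem)
open Summit.QuantumFields.BalabanUV.T4Continuum.SubstrateBackgroundTransporters (unitMod)
open Summit.QuantumFields.BalabanUV.T4Continuum.SubstrateTwoRunsDriven (DrivenRuns)
open Summit.QuantumFields.BalabanUV.T4Continuum.SubstrateRawSpecies
open Summit.QuantumFields.BalabanUV.T4Continuum.SubstrateSlotsOfRecord
open Summit.QuantumFields.BalabanUV.T4Continuum.SubstrateSlotsOfRecordShift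
open Summit.QuantumFields.BalabanUV.T4Continuum.B13ReadingsLevelWindow (ReadsTowerCovAOn ReadsTowerCovBOn)
open Summit.QuantumFields.BalabanUV.T4Continuum.B13ReadingsRecordWindow
open Summit.QuantumFields.BalabanUV.T4Continuum.BalabanAveragedTowerUnit (idx Qlev)
open Summit.QuantumFields.BalabanUV.T4Continuum.GaugeTermScalarData (QuT Q1)
open Summit.QuantumFields.BalabanUV.T4Continuum.RegularSiteTransporters (siteT)
open Summit.QuantumFields.BalabanUV.T4Continuum.RegularBackgroundTower (RegularTransporters regClass)
open Summit.QuantumFields.BalabanUV.T4Continuum.NE2FromNE3 (bgReadings)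
open Summit.QuantumFields.BalabanUV.T4Continuum.NE2ColourPerturbedLayer (pertCovC)
open Summit.QuantumFields.BalabanUV.T4Continuum.NE2BalabanRoot (balabanPert)
open Summit.QuantumFields.BalabanUV.T4Continuum.NE2BalabanGauge (gaugeSlot liftR)
open Summit.QuantumFields.BalabanUV.T4Continuum.NE2BalabanThreshold (etaStar)

/-! ## §1 E1-insOp of record at Bałaban's tier-B background, STATED AT THE SUBSTRATE's COV-SHIFTED O1 INSTANCE (W-21), W1 ON THE RATE ROAD (W-21c) -/

section Instance

-- the substrate's telescope for `slotsOfRecordShift` (W-21; the same letters as p220104 §SlotsRecord, names as in `SubstrateO1ReadingsShiftRate`)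
variable {𝔾 : Type} [GaugeGroup 𝔾] (D : DrivenRuns 𝔾)
variable {oc : Type} [Fintype oc] [DecidableEq oc] (ιr : 𝔾 →* Matrix oc oc ℂ) (cc : ℂ) (ag : ℝ) (sg : ℕ → ℂ)
variable {T ι' Sy Ω 𝒴 : Type} (Pm : MeasPotFrame D.carriers) {IOp : Type*} [NormedAddCommGroup IOp] [NormedSpace ℂ IOp]
  (𝒵 : D.carriers.Dom → InnerLabel D.carriers.Dom (Bnd D.toTwoRuns) → Type) [∀ Z j, Fintype (𝒵 Z j)] (domZ : ∀ Z j, 𝒵 Z j → D.carriers.Dom)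
  (Jc : D.carriers.Dom → InnerLabel D.carriers.Dom (Bnd D.toTwoRuns) → Type) [∀ Z j, Fintype (Jc Z j)]
  (Vv : D.carriers.Dom → InnerLabel D.carriers.Dom (Bnd D.toTwoRuns) → Type) [∀ Z j, NormedAddCommGroup (Vv Z j)]
  [∀ Z j, InnerProductSpace ℝ (Vv Z j)] [∀ Z j, MeasurableSpace (Vv Z j)] [∀ Z j, BorelSpace (Vv Z j)] [∀ Z j, FiniteDimensional ℝ (Vv Z j)]
  (mI : D.carriers.Dom → InnerLabel D.carriers.Dom (Bnd D.toTwoRuns) → Type) [∀ Z j, Fintype (mI Z j)] [∀ Z j, DecidableEq (mI Z j)]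
  (Lsl : SlotLetters D (o := oc) (T := T) (ι' := ι') (S := Sy) (Ω := Ω) (𝒴 := 𝒴) Pm (IOp := IOp) 𝒵 domZ Jc Vv mI)
-- row NE2's ∕ the owner's letters (sizes; node NE3 does not occur — R58)
variable {d : ℕ} (L : ℕ) [NeZero L] (M : Fin d → ℕ) [hM : ∀ μ, NeZero (M μ)] (a : ℝ) (ha : 0 < a)
variable {o : Type*} [Fintype o] [DecidableEq o] {α β C a' η : ℝ} {m : Type*} [Fintype m] [DecidableEq m] {BgD ιp Xp : Type*}

/-- [folklore] **THE TERMWISE END FACE OF RECORD WITH W4 PRODUCED, W1 PRODUCED AT BAŁABAN's TIER-B BACKGROUND, ARITHMETIC LETTERS ELIMINATED — AT THE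
SUBSTRATE's COV-SHIFTED O1 INSTANCE (W-21, owner R53 ∕ R54), W1 ON THE RATE ROAD (W-21c, owner R58)** `S₀ := slotsOfRecordShift D ιr cc ag sg Pm 𝒵 domZ Jc Vv mI Lsl`: this lineage's
`B13StepEndArithmetic.exists_ne5_of_record_insOp S₀ E₀ cB` with `hwer` SUPPLIED BY NAME by substrate-p1's W-21c
`SubstrateO1ReadingsShiftRate.weightedEntrywiseRate_slotsOfRecordShift_balaban_rate` (run B's covariance species read ONE LEVEL DEEPER at the aligned index; the reading
binders below are W-21c's VERBATIM) (so `0 ≤ θ < 1`, row NE2's per-background two-level-consistency binder `hloc` (OPEN row input — for averaging towers of regular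
fields it is NE2's bridge `NE2FromNE3BavgBridge.localRate_regClass_of_bavg_consistent`), the potential readings' rate `hRp` on an abstract carrier `Rp`, the class ∕
threshold letters `hreg hα hβ hC ha' hαη hβη hη` and the owner's O1 letters AT THE SUBSTRATE's TABLES `hdec … hR` are displayed instead; node NE3 does NOT occur;
run A read THROUGH THE TRANSPORTER),
`hc₁ ∕ hθ0 ∕ hθ1` discharged (p225077 §1), L01's `TransportReads` REPLACED by the factorisation datum `(iopAt, hiopA)` (O1-e's `transportReads_of_insOpAt`),
margins and age damping read off the letters (`Lsl.rOp`, `Lsl.rHist`, `Lsl.ins.ω`); EVERY OTHER binder VERBATIM at the instance.  Conclusion LITERALLY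
`∃ C₅, T4OutputRate.NE5 (B13StepOfRecord.outA (slotsOfRecordShift …) E₀ cB) (B13StepOfRecord.outB (slotsOfRecordShift …) E₀ cB) W κ θ′ C₅` at the PRESCRIBED `θ′`.
NOT a proof of NE5 ∕ NE2: an implication from displayed binders about the substrate's letters and row NE2's rate; nothing of Bałaban's is asserted. -/
theorem exists_ne5_of_substrateShift_insOp_balaban_rate (E₀ cB : ℝ)
    {dom : Set BgD} (hL : 2 ≤ L) (hd : 1 ≤ d)
    {RgV : BgD → ((k : ℕ) → Fin d → (Tor (fine (lev L k) M) → Matrix o o ℂ))}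
    (hreg : ∀ V ∈ dom, RegularTransporters L M (liftR L M (RgV V)) α β) (hα : 0 ≤ α) (hβ : 0 ≤ β) (hC : 0 ≤ C) {θ : ℝ}
    (hθ0 : 0 ≤ θ) (hθ1 : θ < 1) (hloc : ∀ V ∈ dom, LocalRate (bgReadings L M (regClass L M (liftR L M (RgV V)))) C θ)
    {Rp : Readings ιp Xp} (hRp : LocalRate Rp C θ)
    (ha' : 0 < a') (hαη : α ≤ η) (hβη : β ≤ η) (hη : η ≤ etaStar o d a a')
    {tow : ℕ → (ℕ → ℝ) → D.toTwoRuns.carriers.BgB → ↥dom} {W : Set (ℕ → ℝ)}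
    {σ : T → ((Tor (unitMod (D.F.P D.K)) × Fin (D.F.P D.K).d) × oc) → idx L M 0 × o} {dist₁ : idx L M 0 × o → idx L M 0 × o → ℝ} {B₁ δ₁ : ℝ}
    (hdec : ∀ V ∈ dom, ∀ k, EntryDecay dist₁
      (pertCovC L M a ha (balabanPert L M a (liftR L M (RgV V)) (gaugeSlot L M (RgV V) (QuT L M o (siteT L M (RgV V))) (Q1 L M o) a'))
        1 k) B₁ δ₁)
    (hcovA : ReadsTowerCovAOn {k : ℕ | k ≤ D.K}
      (fun V : ↥dom => pertCovC L M a ha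
        (balabanPert L M a (liftR L M (RgV V)) (gaugeSlot L M (RgV V) (QuT L M o (siteT L M (RgV V))) (Q1 L M o) a')) 1)
      σ tow (fun g U k => (rawAOfRecord ιr D cc ag sg Lsl.ΓA Lsl.dkA Lsl.gcA Lsl.pQA Lsl.pRA) g (D.toTwoRuns.carriers.transport U) k) W)
    (hcovB : ReadsTowerCovBOn {k : ℕ | k ≤ D.K}
      (fun V : ↥dom => pertCovC L M a ha
        (balabanPert L M a (liftR L M (RgV V)) (gaugeSlot L M (RgV V) (QuT L M o (siteT L M (RgV V))) (Q1 L M o) a')) 1)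
      σ tow (rawBOfRecordShift D ιr cc ag sg Lsl.ΓB Lsl.dkB Lsl.gcB Lsl.pQB Lsl.pRB) W)
    (hdom₁ : CovWeightDominatesDist (slotsOfRecordShift D ιr cc ag sg Pm 𝒵 domZ Jc Vv mI Lsl).F dist₁ σ (δ₁ / 2))
    {S₂ : Set (Matrix (idx L M 0 × o) (idx L M 0 × o) ℂ)} {Φ : T → Matrix (idx L M 0 × o) (idx L M 0 × o) ℂ → Matrix m m ℂ}
    {Λ₂ : ℝ} (hΦ : ∀ t, OpLipschitzOn S₂ (Φ t) Λ₂) (hΛ₂ : 0 ≤ Λ₂)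
    (hS₂ : ∀ V ∈ dom, ∀ k, pertCovC L M a ha
      (balabanPert L M a (liftR L M (RgV V)) (gaugeSlot L M (RgV V) (QuT L M o (siteT L M (RgV V))) (Q1 L M o) a')) 1 k ∈ S₂)
    {dist₂ : m → m → ℝ} {B₂ δ₂ : ℝ}
    (hdecΦ : ∀ V ∈ dom, ∀ t k, EntryDecay dist₂ (Φ t (pertCovC L M a ha
      (balabanPert L M a (liftR L M (RgV V)) (gaugeSlot L M (RgV V) (QuT L M o (siteT L M (RgV V))) (Q1 L M o) a')) 1 k)) B₂ δ₂)
    {σX : T → ι' → m}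
    (hΔA : ReadsTowerDeltaA (fun (V : ↥dom) t k => Φ t (pertCovC L M a ha
      (balabanPert L M a (liftR L M (RgV V)) (gaugeSlot L M (RgV V) (QuT L M o (siteT L M (RgV V))) (Q1 L M o) a')) 1 k))
      σX tow (fun g U k => (rawAOfRecord ιr D cc ag sg Lsl.ΓA Lsl.dkA Lsl.gcA Lsl.pQA Lsl.pRA) g (D.toTwoRuns.carriers.transport U) k) W)
    (hΔB : ReadsTowerDeltaB (fun (V : ↥dom) t k => Φ t (pertCovC L M a ha
      (balabanPert L M a (liftR L M (RgV V)) (gaugeSlot L M (RgV V) (QuT L M o (siteT L M (RgV V))) (Q1 L M o) a')) 1 k))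
      σX tow (rawBOfRecordShift D ιr cc ag sg Lsl.ΓB Lsl.dkB Lsl.gcB Lsl.pQB Lsl.pRB) W)
    (hdom₂ : DeltaWeightDominatesDist (slotsOfRecordShift D ιr cc ag sg Pm 𝒵 domZ Jc Vv mI Lsl).F dist₂ σX (δ₂ / 2))
    {S₃ : Set (Matrix (idx L M 0 × o) (idx L M 0 × o) ℂ)} {Ψ : T → Matrix (idx L M 0 × o) (idx L M 0 × o) ℂ → Matrix m m ℂ}
    {Λ₃ : ℝ} (hΨ : ∀ t, OpLipschitzOn S₃ (Ψ t) Λ₃) (hΛ₃ : 0 ≤ Λ₃)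
    (hS₃ : ∀ V ∈ dom, ∀ k, pertCovC L M a ha
      (balabanPert L M a (liftR L M (RgV V)) (gaugeSlot L M (RgV V) (QuT L M o (siteT L M (RgV V))) (Q1 L M o) a')) 1 k ∈ S₃)
    {dist₃ : m → m → ℝ} {B₃ δ₃ : ℝ}
    (hdecΨ : ∀ V ∈ dom, ∀ t k, EntryDecay dist₃ (Ψ t (pertCovC L M a ha
      (balabanPert L M a (liftR L M (RgV V)) (gaugeSlot L M (RgV V) (QuT L M o (siteT L M (RgV V))) (Q1 L M o) a')) 1 k)) B₃ δ₃)
    {σB : T → ((Tor (unitMod (D.F.P D.K)) × Fin (D.F.P D.K).d) × oc) → m}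
    (hΓA : ReadsTowerGammaA (fun (V : ↥dom) t k => Ψ t (pertCovC L M a ha
      (balabanPert L M a (liftR L M (RgV V)) (gaugeSlot L M (RgV V) (QuT L M o (siteT L M (RgV V))) (Q1 L M o) a')) 1 k))
      σB σX tow (fun g U k => (rawAOfRecord ιr D cc ag sg Lsl.ΓA Lsl.dkA Lsl.gcA Lsl.pQA Lsl.pRA) g (D.toTwoRuns.carriers.transport U) k) W)
    (hΓB : ReadsTowerGammaB (fun (V : ↥dom) t k => Ψ t (pertCovC L M a ha
      (balabanPert L M a (liftR L M (RgV V)) (gaugeSlot L M (RgV V) (QuT L M o (siteT L M (RgV V))) (Q1 L M o) a')) 1 k))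
      σB σX tow (rawBOfRecordShift D ιr cc ag sg Lsl.ΓB Lsl.dkB Lsl.gcB Lsl.pQB Lsl.pRB) W)
    (hdom₃ : GammaWeightDominatesDist (slotsOfRecordShift D ιr cc ag sg Pm 𝒵 domZ Jc Vv mI Lsl).F dist₃ σB σX (δ₃ / 2))
    {Λ₄ Λ₅ : ℝ} (hΛ₄ : 0 ≤ Λ₄) (hΛ₅ : 0 ≤ Λ₅)
    (hQ : PotQLipschitzReading Rp (slotsOfRecordShift D ιr cc ag sg Pm 𝒵 domZ Jc Vv mI Lsl).F
      (fun g U k => (rawAOfRecord ιr D cc ag sg Lsl.ΓA Lsl.dkA Lsl.gcA Lsl.pQA Lsl.pRA) g (D.toTwoRuns.carriers.transport U) k) (rawBOfRecordShift D ιr cc ag sg Lsl.ΓB Lsl.dkB Lsl.gcB Lsl.pQB Lsl.pRB) W Λ₄)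
    (hR : PotRLipschitzReading Rp (slotsOfRecordShift D ιr cc ag sg Pm 𝒵 domZ Jc Vv mI Lsl).F
      (fun g U k => (rawAOfRecord ιr D cc ag sg Lsl.ΓA Lsl.dkA Lsl.gcA Lsl.pQA Lsl.pRA) g (D.toTwoRuns.carriers.transport U) k) (rawBOfRecordShift D ιr cc ag sg Lsl.ΓB Lsl.dkB Lsl.gcB Lsl.pQB Lsl.pRB) W Λ₅)
    -- L01's reading: the factorisation datum of run A's insertion-operator letter through the transport (replaces `hT`)
    (iopAt : ℝ → D.carriers.BgA → ℕ → IOp)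
    (hiopA : ∀ (r : ℝ) (U : D.carriers.BgB) (k : ℕ), Lsl.ins.iopA r U k = iopAt r (D.carriers.transport U) k)
    -- the rest of p225077 §2 VERBATIM at the instance
    {ROp RHist : ℕ → ℝ} {aw : ℕ → TermIdx D.toTwoRuns.carriers.Dom (Bnd D.toTwoRuns) → ℝ} {κ G EA₀ cA r₀ Gi δI θ' : ℝ} (rI : ℕ → ℝ)
    (hrI : ∀ k, 0 < rI k)
    (hbB : (assembly (slotsOfRecordShift D ιr cc ag sg Pm 𝒵 domZ Jc Vv mI Lsl)).SliceBudgetB W κ cB)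
    (hbA : (slotsOfRecordShift D ιr cc ag sg Pm 𝒵 domZ Jc Vv mI Lsl).D.SliceBudget (step (slotsOfRecordShift D ιr cc ag sg Pm 𝒵 domZ Jc Vv mI Lsl) E₀ cB) W κ cA)
    (hdA : DecayBound (outA (slotsOfRecordShift D ιr cc ag sg Pm 𝒵 domZ Jc Vv mI Lsl) E₀ cB) W EA₀ κ)
    (hdB : DecayBound (outB (slotsOfRecordShift D ιr cc ag sg Pm 𝒵 domZ Jc Vv mI Lsl) E₀ cB) W E₀ κ)
    (hRA : RawBounded (slotsOfRecordShift D ιr cc ag sg Pm 𝒵 domZ Jc Vv mI Lsl).F (assembly (slotsOfRecordShift D ιr cc ag sg Pm 𝒵 domZ Jc Vv mI Lsl)).rawAt W)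
    (hRB : RawBounded (slotsOfRecordShift D ιr cc ag sg Pm 𝒵 domZ Jc Vv mI Lsl).F (slotsOfRecordShift D ιr cc ag sg Pm 𝒵 domZ Jc Vv mI Lsl).rawB W)
    (hfl : ∀ k, r₀ ≤ Lsl.rOp k)
    (hienv : ((slotsOfRecordShift D ιr cc ag sg Pm 𝒵 domZ Jc Vv mI Lsl).D.toInsOpModel
      (step (slotsOfRecordShift D ιr cc ag sg Pm 𝒵 domZ Jc Vv mI Lsl) E₀ cB) rI hrI).InsOpEnvelope W κ E₀ Gi)
    (hibdA : ((slotsOfRecordShift D ιr cc ag sg Pm 𝒵 domZ Jc Vv mI Lsl).D.toInsOpModel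
      (step (slotsOfRecordShift D ιr cc ag sg Pm 𝒵 domZ Jc Vv mI Lsl) E₀ cB) rI hrI).InsBoundA W κ E₀ Gi)
    (hirate : ((slotsOfRecordShift D ιr cc ag sg Pm 𝒵 domZ Jc Vv mI Lsl).D.toInsOpModel
      (step (slotsOfRecordShift D ιr cc ag sg Pm 𝒵 domZ Jc Vv mI Lsl) E₀ cB) rI hrI).InsOpRate W δI (Real.sqrt (max θ ((L : ℝ)⁻¹))))
    (hδI : 0 ≤ δI) (hGi : 0 ≤ Gi)
    (hbd : TermBound (ballClass (selfCtr (assembly (slotsOfRecordShift D ιr cc ag sg Pm 𝒵 domZ Jc Vv mI Lsl)).raw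
        (assembly (slotsOfRecordShift D ιr cc ag sg Pm 𝒵 domZ Jc Vv mI Lsl)).histRef) ROp RHist)
      (term (assembly (slotsOfRecordShift D ιr cc ag sg Pm 𝒵 domZ Jc Vv mI Lsl)).𝒯 (assembly (slotsOfRecordShift D ιr cc ag sg Pm 𝒵 domZ Jc Vv mI Lsl)).inc
        (slotsOfRecordShift D ιr cc ag sg Pm 𝒵 domZ Jc Vv mI Lsl).act) W κ aw)
    (hbud : TermBudget aw G)
    (hline : TermLineAnalytic (ballClass (selfCtr (assembly (slotsOfRecordShift D ιr cc ag sg Pm 𝒵 domZ Jc Vv mI Lsl)).raw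
        (assembly (slotsOfRecordShift D ιr cc ag sg Pm 𝒵 domZ Jc Vv mI Lsl)).histRef) ROp RHist)
      (term (assembly (slotsOfRecordShift D ιr cc ag sg Pm 𝒵 domZ Jc Vv mI Lsl)).𝒯 (assembly (slotsOfRecordShift D ιr cc ag sg Pm 𝒵 domZ Jc Vv mI Lsl)).inc
        (slotsOfRecordShift D ιr cc ag sg Pm 𝒵 domZ Jc Vv mI Lsl).act) W)
    (hOp : ∀ k, Lsl.rOp k ≤ ROp k)
    (hHist : ∀ k, (assembly (slotsOfRecordShift D ιr cc ag sg Pm 𝒵 domZ Jc Vv mI Lsl)).bHist E₀ cB k + Lsl.rHist k ≤ RHist k)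
    (hE₀ : 0 ≤ E₀) (hG : 0 ≤ G) (hcA : 0 ≤ cA) (hcB : 0 ≤ cB) (hr₀ : 0 < r₀)
    (hθθ' : Real.sqrt (max θ ((L : ℝ)⁻¹)) ≤ θ') (hθ'1 : θ' ≤ 1) (hω : 0 < Lsl.ins.ω) (hω1 : Lsl.ins.ω < 1)
    (hh : cA * (EA₀ + E₀) < 1 - Lsl.ins.ω)
    (hsmall : Lsl.ins.ω + G * cA * (1 - Lsl.ins.ω) / (1 - Lsl.ins.ω - cA * (EA₀ + E₀)) < θ') :
    ∃ C₅, NE5 (outA (slotsOfRecordShift D ιr cc ag sg Pm 𝒵 domZ Jc Vv mI Lsl) E₀ cB)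
      (outB (slotsOfRecordShift D ιr cc ag sg Pm 𝒵 domZ Jc Vv mI Lsl) E₀ cB) W κ θ' C₅ :=
  exists_ne5_of_record_insOp (slotsOfRecordShift D ιr cc ag sg Pm 𝒵 domZ Jc Vv mI Lsl) E₀ cB rI hrI
    ((assembly (slotsOfRecordShift D ιr cc ag sg Pm 𝒵 domZ Jc Vv mI Lsl)).transportReads_of_insOpAt
      (insOpA' := fun g U k => iopAt (g (k - 1)) U k) (fun g U k => hiopA (g (k - 1)) U k) W)
    hbB hbA hdA hdB hRA hRB
    (weightedEntrywiseRate_slotsOfRecordShift_balaban_rate D ιr cc ag sg Pm 𝒵 domZ Jc Vv mI Lsl L M a ha hL hd hreg hα hβ hC hθ0 hθ1 hloc hRp ha' hαη hβη hη hdec hcovA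
      hcovB hdom₁ hΦ hΛ₂ hS₂ hdecΦ hΔA hΔB hdom₂ hΨ hΛ₃ hS₃ hdecΨ hΓA hΓB hdom₃ hΛ₄ hΛ₅ hQ hR)
    hfl hienv hibdA hirate hδI hGi hbd hbud hline hOp hHist hE₀ hG hcA hcB (c1_balaban_nonneg L a hC hΛ₄ hΛ₅) hr₀
    (sqrt_rate_pos_lt_one L hL hθ1).1 (sqrt_rate_pos_lt_one L hL hθ1).2 hθθ' hθ'1 hω hω1 hh hsmall

end Instance

/-! ## §2 One constant for every driven two-run object and every letter package (η-uniformity at the cov-shifted instance, rate road) -/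

section Uniform

variable {d : ℕ} (L : ℕ) [NeZero L] (M : Fin d → ℕ) [hM : ∀ μ, NeZero (M μ)] (a : ℝ) (ha : 0 < a)
variable {o : Type*} [Fintype o] [DecidableEq o] {α β C a' η θ : ℝ} {m : Type*} [Fintype m] [DecidableEq m]

/-- [folklore] **ONE CONSTANT FOR EVERY DRIVEN TWO-RUN OBJECT AND EVERY LETTER PACKAGE (η-UNIFORMITY AT THE SUBSTRATE's COV-SHIFTED O1 INSTANCE, W-21), W1 PRODUCED AT
BAŁABAN's TIER-B BACKGROUND BY W-21c ON THE RATE ROAD, LETTERS ELIMINATED** — this lineage's `B13StepEndArithmetic.uniform_ne5_of_record_insOp` (entry type quantified INSIDE `∃ C₅`) with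
`c₁ :=` W1's assembled constant and `θ := √(max θ L⁻¹)` (both SIZES), its `hwer` binder supplied per two-run object and letter package by substrate-p1's W-21c
`weightedEntrywiseRate_slotsOfRecordShift_balaban_rate`, its `hT` by the factorisation datum.  Fix the SIZES (`κ, G, EA₀, E₀, cA, cB, r₀, Gi, δI, θ′, ω`, the
letters of W1's constant `o, d, L, a, α, β, C, a′, B₁, B₂, B₃, Λ₂, …, Λ₅`, `0 ≤ θ < 1`), subject to `√(max θ L⁻¹) ≤ θ′ ≤ 1` and the TWO STRICT SIZE INEQUALITIES.
Then ONE `C₅` serves EVERY gauge group `𝔾`, driven two-run object `D : DrivenRuns 𝔾`, representation `ιr`, letters `cc ag sg`, frame `Pm`, insertion-operator sort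
`IOp`, factor index data `𝒵 domZ Jc Vv mI`, EVERY letter package `Lsl` with `Lsl.ins.ω = ω` and factorisation datum `(iopAt, hiopA)`, EVERY datum type `BgD` with
admissible data `dom ∕ RgV` in the (3.35)-class and row NE2's per-background `LocalRate … C θ`, EVERY potential-readings carrier `Rp : Readings ιp Xp` with
`LocalRate Rp C θ`, towers over `D`'s run-B backgrounds, O1 letters at the substrate's tables, window, margins `rI`, roomy class: the displayed binders IMPLY `NE5 (B13StepOfRecord.outA (slotsOfRecordShift …) E₀ cB) (B13StepOfRecord.outB (slotsOfRecordShift …) E₀ cB) W κ θ′ C₅`.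
NOT a proof of NE5 ∕ NE2: an implication from displayed binders, the quantifier order `∃ C₅, ∀ 𝔾 D … Lsl … BgD … Rp …` being the point; node NE3 does not occur. -/
theorem uniform_ne5_of_substrateShift_insOp_balaban_rate (hL : 2 ≤ L) (hd : 1 ≤ d) (hα : 0 ≤ α) (hβ : 0 ≤ β) (hC : 0 ≤ C) (ha' : 0 < a')
    (hαη : α ≤ η) (hβη : β ≤ η) (hη : η ≤ etaStar o d a a') {B₁ B₂ B₃ Λ₂ Λ₃ Λ₄ Λ₅ : ℝ} (hΛ₂ : 0 ≤ Λ₂) (hΛ₃ : 0 ≤ Λ₃)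
    (hΛ₄ : 0 ≤ Λ₄) (hΛ₅ : 0 ≤ Λ₅) (hθ0 : 0 ≤ θ) (hθ1 : θ < 1) {κ G EA₀ E₀ cA cB r₀ Gi δI θ' ω : ℝ}
    (hE₀ : 0 ≤ E₀) (hG : 0 ≤ G) (hcA : 0 ≤ cA) (hcB : 0 ≤ cB) (hr₀ : 0 < r₀) (hGi : 0 ≤ Gi) (hδI : 0 ≤ δI)
    (hθθ' : Real.sqrt (max θ ((L : ℝ)⁻¹)) ≤ θ') (hθ'1 : θ' ≤ 1) (hω : 0 < ω) (hω1 : ω < 1)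
    (hh : cA * (EA₀ + E₀) < 1 - ω) (hsmall : ω + G * cA * (1 - ω) / (1 - ω - cA * (EA₀ + E₀)) < θ') :
    ∃ C₅ : ℝ, ∀ {𝔾 : Type} [GaugeGroup 𝔾] (D : DrivenRuns 𝔾) {oc : Type} [Fintype oc] [DecidableEq oc] (ιr : 𝔾 →* Matrix oc oc ℂ) (cc : ℂ)
      (ag : ℝ) (sg : ℕ → ℂ) {T ι' Sy Ω 𝒴 : Type} (Pm : MeasPotFrame D.carriers) {IOp : Type*} [NormedAddCommGroup IOp] [NormedSpace ℂ IOp]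
      (𝒵 : D.carriers.Dom → InnerLabel D.carriers.Dom (Bnd D.toTwoRuns) → Type) [∀ Z j, Fintype (𝒵 Z j)]
      (domZ : ∀ Z j, 𝒵 Z j → D.carriers.Dom) (Jc : D.carriers.Dom → InnerLabel D.carriers.Dom (Bnd D.toTwoRuns) → Type)
      [∀ Z j, Fintype (Jc Z j)] (Vv : D.carriers.Dom → InnerLabel D.carriers.Dom (Bnd D.toTwoRuns) → Type)
      [∀ Z j, NormedAddCommGroup (Vv Z j)] [∀ Z j, InnerProductSpace ℝ (Vv Z j)] [∀ Z j, MeasurableSpace (Vv Z j)] [∀ Z j, BorelSpace (Vv Z j)]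
      [∀ Z j, FiniteDimensional ℝ (Vv Z j)] (mI : D.carriers.Dom → InnerLabel D.carriers.Dom (Bnd D.toTwoRuns) → Type)
      [∀ Z j, Fintype (mI Z j)] [∀ Z j, DecidableEq (mI Z j)]
      (Lsl : SlotLetters D (o := oc) (T := T) (ι' := ι') (S := Sy) (Ω := Ω) (𝒴 := 𝒴) Pm (IOp := IOp) 𝒵 domZ Jc Vv mI)
      (iopAt : ℝ → D.carriers.BgA → ℕ → IOp)
      {BgD ιp Xp : Type*} {dom : Set BgD}
      {RgV : BgD → ((k : ℕ) → Fin d → (Tor (fine (lev L k) M) → Matrix o o ℂ))} {Rp : Readings ιp Xp}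
      {tow : ℕ → (ℕ → ℝ) → D.toTwoRuns.carriers.BgB → ↥dom} {W : Set (ℕ → ℝ)}
      {σ : T → ((Tor (unitMod (D.F.P D.K)) × Fin (D.F.P D.K).d) × oc) → idx L M 0 × o} {dist₁ : idx L M 0 × o → idx L M 0 × o → ℝ} {δ₁ : ℝ}
      {S₂ : Set (Matrix (idx L M 0 × o) (idx L M 0 × o) ℂ)} {Φ : T → Matrix (idx L M 0 × o) (idx L M 0 × o) ℂ → Matrix m m ℂ}
      {dist₂ : m → m → ℝ} {δ₂ : ℝ} {σX : T → ι' → m}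
      {S₃ : Set (Matrix (idx L M 0 × o) (idx L M 0 × o) ℂ)} {Ψ : T → Matrix (idx L M 0 × o) (idx L M 0 × o) ℂ → Matrix m m ℂ}
      {dist₃ : m → m → ℝ} {δ₃ : ℝ} {σB : T → ((Tor (unitMod (D.F.P D.K)) × Fin (D.F.P D.K).d) × oc) → m}
      {ROp RHist : ℕ → ℝ} {aw : ℕ → TermIdx D.toTwoRuns.carriers.Dom (Bnd D.toTwoRuns) → ℝ} (rI : ℕ → ℝ) (hrI : ∀ k, 0 < rI k),
      Lsl.ins.ω = ω →
      (∀ (r : ℝ) (U : D.carriers.BgB) (k : ℕ), Lsl.ins.iopA r U k = iopAt r (D.carriers.transport U) k) →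
      (∀ V ∈ dom, RegularTransporters L M (liftR L M (RgV V)) α β) →
      (∀ V ∈ dom, LocalRate (bgReadings L M (regClass L M (liftR L M (RgV V)))) C θ) →
      LocalRate Rp C θ →
      (∀ V ∈ dom, ∀ k, EntryDecay dist₁
        (pertCovC L M a ha (balabanPert L M a (liftR L M (RgV V)) (gaugeSlot L M (RgV V) (QuT L M o (siteT L M (RgV V))) (Q1 L M o) a'))
          1 k) B₁ δ₁) →
      ReadsTowerCovAOn {k : ℕ | k ≤ D.K}
        (fun V : ↥dom => pertCovC L M a ha
          (balabanPert L M a (liftR L M (RgV V)) (gaugeSlot L M (RgV V) (QuT L M o (siteT L M (RgV V))) (Q1 L M o) a')) 1)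
        σ tow (fun g U k => (rawAOfRecord ιr D cc ag sg Lsl.ΓA Lsl.dkA Lsl.gcA Lsl.pQA Lsl.pRA) g (D.toTwoRuns.carriers.transport U) k) W →
      ReadsTowerCovBOn {k : ℕ | k ≤ D.K}
        (fun V : ↥dom => pertCovC L M a ha
          (balabanPert L M a (liftR L M (RgV V)) (gaugeSlot L M (RgV V) (QuT L M o (siteT L M (RgV V))) (Q1 L M o) a')) 1)
        σ tow (rawBOfRecordShift D ιr cc ag sg Lsl.ΓB Lsl.dkB Lsl.gcB Lsl.pQB Lsl.pRB) W →
      CovWeightDominatesDist (slotsOfRecordShift D ιr cc ag sg Pm 𝒵 domZ Jc Vv mI Lsl).F dist₁ σ (δ₁ / 2) →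
      (∀ t, OpLipschitzOn S₂ (Φ t) Λ₂) →
      (∀ V ∈ dom, ∀ k, pertCovC L M a ha
        (balabanPert L M a (liftR L M (RgV V)) (gaugeSlot L M (RgV V) (QuT L M o (siteT L M (RgV V))) (Q1 L M o) a')) 1 k ∈ S₂) →
      (∀ V ∈ dom, ∀ t k, EntryDecay dist₂ (Φ t (pertCovC L M a ha
        (balabanPert L M a (liftR L M (RgV V)) (gaugeSlot L M (RgV V) (QuT L M o (siteT L M (RgV V))) (Q1 L M o) a')) 1 k)) B₂ δ₂) →
      ReadsTowerDeltaA (fun (V : ↥dom) t k => Φ t (pertCovC L M a ha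
        (balabanPert L M a (liftR L M (RgV V)) (gaugeSlot L M (RgV V) (QuT L M o (siteT L M (RgV V))) (Q1 L M o) a')) 1 k))
        σX tow (fun g U k => (rawAOfRecord ιr D cc ag sg Lsl.ΓA Lsl.dkA Lsl.gcA Lsl.pQA Lsl.pRA) g (D.toTwoRuns.carriers.transport U) k) W →
      ReadsTowerDeltaB (fun (V : ↥dom) t k => Φ t (pertCovC L M a ha
        (balabanPert L M a (liftR L M (RgV V)) (gaugeSlot L M (RgV V) (QuT L M o (siteT L M (RgV V))) (Q1 L M o) a')) 1 k))
        σX tow (rawBOfRecordShift D ιr cc ag sg Lsl.ΓB Lsl.dkB Lsl.gcB Lsl.pQB Lsl.pRB) W →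
      DeltaWeightDominatesDist (slotsOfRecordShift D ιr cc ag sg Pm 𝒵 domZ Jc Vv mI Lsl).F dist₂ σX (δ₂ / 2) →
      (∀ t, OpLipschitzOn S₃ (Ψ t) Λ₃) →
      (∀ V ∈ dom, ∀ k, pertCovC L M a ha
        (balabanPert L M a (liftR L M (RgV V)) (gaugeSlot L M (RgV V) (QuT L M o (siteT L M (RgV V))) (Q1 L M o) a')) 1 k ∈ S₃) →
      (∀ V ∈ dom, ∀ t k, EntryDecay dist₃ (Ψ t (pertCovC L M a ha
        (balabanPert L M a (liftR L M (RgV V)) (gaugeSlot L M (RgV V) (QuT L M o (siteT L M (RgV V))) (Q1 L M o) a')) 1 k)) B₃ δ₃) →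
      ReadsTowerGammaA (fun (V : ↥dom) t k => Ψ t (pertCovC L M a ha
        (balabanPert L M a (liftR L M (RgV V)) (gaugeSlot L M (RgV V) (QuT L M o (siteT L M (RgV V))) (Q1 L M o) a')) 1 k))
        σB σX tow (fun g U k => (rawAOfRecord ιr D cc ag sg Lsl.ΓA Lsl.dkA Lsl.gcA Lsl.pQA Lsl.pRA) g (D.toTwoRuns.carriers.transport U) k) W →
      ReadsTowerGammaB (fun (V : ↥dom) t k => Ψ t (pertCovC L M a ha
        (balabanPert L M a (liftR L M (RgV V)) (gaugeSlot L M (RgV V) (QuT L M o (siteT L M (RgV V))) (Q1 L M o) a')) 1 k))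
        σB σX tow (rawBOfRecordShift D ιr cc ag sg Lsl.ΓB Lsl.dkB Lsl.gcB Lsl.pQB Lsl.pRB) W →
      GammaWeightDominatesDist (slotsOfRecordShift D ιr cc ag sg Pm 𝒵 domZ Jc Vv mI Lsl).F dist₃ σB σX (δ₃ / 2) →
      PotQLipschitzReading Rp (slotsOfRecordShift D ιr cc ag sg Pm 𝒵 domZ Jc Vv mI Lsl).F
        (fun g U k => (rawAOfRecord ιr D cc ag sg Lsl.ΓA Lsl.dkA Lsl.gcA Lsl.pQA Lsl.pRA) g (D.toTwoRuns.carriers.transport U) k) (rawBOfRecordShift D ιr cc ag sg Lsl.ΓB Lsl.dkB Lsl.gcB Lsl.pQB Lsl.pRB) W Λ₄ →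
      PotRLipschitzReading Rp (slotsOfRecordShift D ιr cc ag sg Pm 𝒵 domZ Jc Vv mI Lsl).F
        (fun g U k => (rawAOfRecord ιr D cc ag sg Lsl.ΓA Lsl.dkA Lsl.gcA Lsl.pQA Lsl.pRA) g (D.toTwoRuns.carriers.transport U) k) (rawBOfRecordShift D ιr cc ag sg Lsl.ΓB Lsl.dkB Lsl.gcB Lsl.pQB Lsl.pRB) W Λ₅ →
      (assembly (slotsOfRecordShift D ιr cc ag sg Pm 𝒵 domZ Jc Vv mI Lsl)).SliceBudgetB W κ cB →
      (slotsOfRecordShift D ιr cc ag sg Pm 𝒵 domZ Jc Vv mI Lsl).D.SliceBudget (step (slotsOfRecordShift D ιr cc ag sg Pm 𝒵 domZ Jc Vv mI Lsl) E₀ cB) W κ cA →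
      DecayBound (outA (slotsOfRecordShift D ιr cc ag sg Pm 𝒵 domZ Jc Vv mI Lsl) E₀ cB) W EA₀ κ →
      DecayBound (outB (slotsOfRecordShift D ιr cc ag sg Pm 𝒵 domZ Jc Vv mI Lsl) E₀ cB) W E₀ κ →
      RawBounded (slotsOfRecordShift D ιr cc ag sg Pm 𝒵 domZ Jc Vv mI Lsl).F (assembly (slotsOfRecordShift D ιr cc ag sg Pm 𝒵 domZ Jc Vv mI Lsl)).rawAt W →
      RawBounded (slotsOfRecordShift D ιr cc ag sg Pm 𝒵 domZ Jc Vv mI Lsl).F (slotsOfRecordShift D ιr cc ag sg Pm 𝒵 domZ Jc Vv mI Lsl).rawB W →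
      (∀ k, r₀ ≤ Lsl.rOp k) →
      ((slotsOfRecordShift D ιr cc ag sg Pm 𝒵 domZ Jc Vv mI Lsl).D.toInsOpModel
        (step (slotsOfRecordShift D ιr cc ag sg Pm 𝒵 domZ Jc Vv mI Lsl) E₀ cB) rI hrI).InsOpEnvelope W κ E₀ Gi →
      ((slotsOfRecordShift D ιr cc ag sg Pm 𝒵 domZ Jc Vv mI Lsl).D.toInsOpModel
        (step (slotsOfRecordShift D ιr cc ag sg Pm 𝒵 domZ Jc Vv mI Lsl) E₀ cB) rI hrI).InsBoundA W κ E₀ Gi →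
      ((slotsOfRecordShift D ιr cc ag sg Pm 𝒵 domZ Jc Vv mI Lsl).D.toInsOpModel
        (step (slotsOfRecordShift D ιr cc ag sg Pm 𝒵 domZ Jc Vv mI Lsl) E₀ cB) rI hrI).InsOpRate W δI (Real.sqrt (max θ ((L : ℝ)⁻¹))) →
      TermBound (ballClass (selfCtr (assembly (slotsOfRecordShift D ιr cc ag sg Pm 𝒵 domZ Jc Vv mI Lsl)).raw
          (assembly (slotsOfRecordShift D ιr cc ag sg Pm 𝒵 domZ Jc Vv mI Lsl)).histRef) ROp RHist)
        (term (assembly (slotsOfRecordShift D ιr cc ag sg Pm 𝒵 domZ Jc Vv mI Lsl)).𝒯 (assembly (slotsOfRecordShift D ιr cc ag sg Pm 𝒵 domZ Jc Vv mI Lsl)).inc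
          (slotsOfRecordShift D ιr cc ag sg Pm 𝒵 domZ Jc Vv mI Lsl).act) W κ aw →
      TermBudget aw G →
      TermLineAnalytic (ballClass (selfCtr (assembly (slotsOfRecordShift D ιr cc ag sg Pm 𝒵 domZ Jc Vv mI Lsl)).raw
          (assembly (slotsOfRecordShift D ιr cc ag sg Pm 𝒵 domZ Jc Vv mI Lsl)).histRef) ROp RHist)
        (term (assembly (slotsOfRecordShift D ιr cc ag sg Pm 𝒵 domZ Jc Vv mI Lsl)).𝒯 (assembly (slotsOfRecordShift D ιr cc ag sg Pm 𝒵 domZ Jc Vv mI Lsl)).inc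
          (slotsOfRecordShift D ιr cc ag sg Pm 𝒵 domZ Jc Vv mI Lsl).act) W →
      (∀ k, Lsl.rOp k ≤ ROp k) →
      (∀ k, (assembly (slotsOfRecordShift D ιr cc ag sg Pm 𝒵 domZ Jc Vv mI Lsl)).bHist E₀ cB k + Lsl.rHist k ≤ RHist k) →
      NE5 (outA (slotsOfRecordShift D ιr cc ag sg Pm 𝒵 domZ Jc Vv mI Lsl) E₀ cB)
        (outB (slotsOfRecordShift D ιr cc ag sg Pm 𝒵 domZ Jc Vv mI Lsl) E₀ cB) W κ θ' C₅ := by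
  obtain ⟨hΘ0, hΘ1⟩ := sqrt_rate_pos_lt_one L hL hθ1
  obtain ⟨C₅, hC₅⟩ := uniform_ne5_of_record_insOp (κ := κ)
    (c₁ := Real.sqrt (2 * B₁ * (2 * CpertRec o d L a α β C a' / (1 - max θ ((L : ℝ)⁻¹)))) +
      Real.sqrt (2 * B₂ * (Λ₂ * CpertRec o d L a α β C a')) + Real.sqrt (2 * B₃ * (Λ₃ * CpertRec o d L a α β C a')) +
      Λ₄ * C + Λ₅ * C)
    hE₀ hG hcA hcB (c1_balaban_nonneg L a hC hΛ₄ hΛ₅) hr₀ hGi hδI hΘ0 hΘ1 hθθ' hθ'1 hω hω1 hh hsmall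
  refine ⟨C₅, ?_⟩
  intro 𝔾 _ D oc _ _ ιr cc ag sg T ι' Sy Ω 𝒴 Pm IOp _ _ 𝒵 _ domZ Jc _ Vv _ _ _ _ _ mI _ _ Lsl iopAt BgD ιp Xp dom RgV Rp tow W σ dist₁ δ₁ S₂ Φ dist₂ δ₂ σX S₃ Ψ dist₃ δ₃ σB
    ROp RHist aw rI hrI hLω hiopA hreg hloc hRp hdec hcovA hcovB hdom₁ hΦ hS₂ hdecΦ hΔA hΔB hdom₂ hΨ hS₃ hdecΨ hΓA hΓB hdom₃ hQ hR hbB hbA hdA hdB hRA hRB hfl hienv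
    hibdA hirate hbd hbud hline hOp hHist
  have hwer := weightedEntrywiseRate_slotsOfRecordShift_balaban_rate D ιr cc ag sg Pm 𝒵 domZ Jc Vv mI Lsl L M a ha hL hd hreg hα hβ hC hθ0 hθ1 hloc hRp ha' hαη hβη hη hdec
    hcovA hcovB hdom₁ hΦ hΛ₂ hS₂ hdecΦ hΔA hΔB hdom₂ hΨ hΛ₃ hS₃ hdecΨ hΓA hΓB hdom₃ hΛ₄ hΛ₅ hQ hR
  exact hC₅ (slotsOfRecordShift D ιr cc ag sg Pm 𝒵 domZ Jc Vv mI Lsl) rI hrI hLω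
    ((assembly (slotsOfRecordShift D ιr cc ag sg Pm 𝒵 domZ Jc Vv mI Lsl)).transportReads_of_insOpAt
      (insOpA' := fun g U k => iopAt (g (k - 1)) U k) (fun g U k => hiopA (g (k - 1)) U k) W)
    hbB hbA hdA hdB hRA hRB hwer hfl hienv hibdA hirate hbd hbud hline hOp hHist

end Uniform

end Summit.QuantumFields.BalabanUV.T4Continuum.B13StepEndInsOpSubstrateShiftRate

end
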